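import Mathlib

/-!
# ValiantsHypothesis / RigidityForcesSymmetry — crux `LaplaceOptimalFive` (stmt-ValiantsHypothesis-24813), crux idea
`young-shadow` (K1) on the star: **(L3-iv) THE RANK OBSTRUCTION — FEW RELATIONS AMONG ROWS ⟹ COLUMNS NEED MANY GENERATORS**
(memo `NOTE-p4g15-24813-K1-star.md` §5/§6 «`|T| ≥ Σ r_j ≥ dim Σ𝒰_j ≥ rank(Hess m + 4E)`»; memo `NOTE-p4g16-…` §2 (L3-iv))

The bridge between the ROW-relation form of the rank bounds (✓ `offDiag_entries_independent`, ✓ `offDiag_relations_of_support_three`: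
every relation `s` among the rows `(a,b) ↦ N(a,b,·)` lies in a small explicit subspace `K`) and the COLUMN-space count of the assembly
(every column `N(·,·,k)` lies in the span of `n` matrices — the pencils).  Linear algebra only (`rank_obstruction`): if the columns of
`N : Fin 5 → Fin 5 → κ → ℂ` lie in the span of `n` matrices and every row relation lies in a submodule `K`, then
`25 ≤ finrank K + n` (rank–nullity for the pairing map `s ↦ (⟨s, v_i⟩)_i`).  With `K = {s : s_{ab} + s_{ba} = 0 (a ≠ b)}`
(`finrank ≤ 15`, `finrank_offDiag_antisym_le`) this gives `n ≥ 10`; with one extra relation direction, `n ≥ 9`.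

No definitions, no `sorry`.  Honest framing: abstract helper for (L3-iv); closes nothing; K1-on-the-star PAPER PASS, not kernel;
`LaplaceOptimalFive` OPEN · CONTESTED 72/120; `VP ≠ VNP` NOT proved.
-/

set_option linter.dupNamespace false

namespace Summit.ValiantsHypothesis.ValiantsHypothesis.Theorems.RigidityForcesSymmetryRankRigidMinimalRepr

namespace LaplaceFiveStar

open Finset Module

/-- **Rank obstruction.**  `N : Fin 5 → Fin 5 → κ → ℂ`; if every column `(a,b) ↦ N a b k` lies in the span of the `n` matrices
`v i`, and every row relation `s` (`Σ_{ab} s_{ab} N(a,b,k) = 0` for all `k`) lies in the submodule `K`, then `25 ≤ finrank K + n`.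
[folklore] -/
theorem rank_obstruction {κ : Type*} {n : ℕ} (N : Fin 5 → Fin 5 → κ → ℂ) (v : Fin n → (Fin 5 → Fin 5 → ℂ))
    (hcol : ∀ k : κ, (fun a b => N a b k) ∈ Submodule.span ℂ (Set.range v))
    (K : Submodule ℂ (Fin 5 → Fin 5 → ℂ))
    (hK : ∀ s : Fin 5 → Fin 5 → ℂ, (∀ k : κ, ∑ a : Fin 5, ∑ b : Fin 5, s a b * N a b k = 0) → s ∈ K) :
    25 ≤ finrank ℂ K + n := by
  classical
  -- the pairing map `π s = (⟨s, v i⟩)_i`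
  let π : (Fin 5 → Fin 5 → ℂ) →ₗ[ℂ] (Fin n → ℂ) :=
    { toFun := fun s i => ∑ a : Fin 5, ∑ b : Fin 5, s a b * v i a b
      map_add' := fun s t => by
        funext i
        simp only [Pi.add_apply, add_mul, Finset.sum_add_distrib]
      map_smul' := fun r s => by
        funext i
        simp only [Pi.smul_apply, smul_eq_mul, RingHom.id_apply, Finset.mul_sum, mul_assoc] }
  -- `ker π ≤ K`: a matrix orthogonal to every `v i` is orthogonal to the span, hence to every column, hence a relation
  have hker : LinearMap.ker π ≤ K := by
    intro s hs
    rw [LinearMap.mem_ker] at hs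
    apply hK
    intro k
    -- the functional `M ↦ ⟨s, M⟩` vanishes on `span (range v)`
    let φ : (Fin 5 → Fin 5 → ℂ) →ₗ[ℂ] ℂ :=
      { toFun := fun M => ∑ a : Fin 5, ∑ b : Fin 5, s a b * M a b
        map_add' := fun M M' => by simp only [Pi.add_apply, mul_add, Finset.sum_add_distrib]
        map_smul' := fun r M => by
          simp only [Pi.smul_apply, smul_eq_mul, RingHom.id_apply, Finset.mul_sum]
          exact Finset.sum_congr rfl fun a _ => Finset.sum_congr rfl fun b _ => by ring }
    have hφv : ∀ i : Fin n, φ (v i) = 0 := fun i => by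
      have := congr_fun hs i
      exact this
    have hspan : ∀ M ∈ Submodule.span ℂ (Set.range v), φ M = 0 := by
      intro M hM
      have hle : Submodule.span ℂ (Set.range v) ≤ LinearMap.ker φ := by
        rw [Submodule.span_le]
        rintro _ ⟨i, rfl⟩
        exact (LinearMap.mem_ker).mpr (hφv i)
      exact (LinearMap.mem_ker).mp (hle hM)
    exact hspan _ (hcol k)
  -- rank–nullity
  have hrn := LinearMap.finrank_range_add_finrank_ker π
  have hdom : finrank ℂ (Fin 5 → Fin 5 → ℂ) = 25 := by
    rw [Module.finrank_pi_fintype]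
    simp [Module.finrank_fintype_fun_eq_card]
  rw [hdom] at hrn
  have hrange : finrank ℂ (LinearMap.range π) ≤ n := by
    calc finrank ℂ (LinearMap.range π) ≤ finrank ℂ (Fin n → ℂ) := Submodule.finrank_le _
      _ = n := by simp
  have hkerK : finrank ℂ (LinearMap.ker π) ≤ finrank ℂ K := Submodule.finrank_mono hker
  omega

/-- The subspace of matrices with antisymmetric off-diagonal part, `{s : s_{ab} + s_{ba} = 0 for a ≠ b}`, has dimension `≤ 15`
(it embeds into `diagonal ⊕ strict upper triangle`). [folklore] -/
theorem finrank_offDiag_antisym_le (K : Submodule ℂ (Fin 5 → Fin 5 → ℂ))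
    (hK : ∀ s ∈ K, ∀ a b : Fin 5, a ≠ b → s a b + s b a = 0) : finrank ℂ K ≤ 15 := by
  classical
  -- restriction to the diagonal and the strict upper triangle
  let ρ : (Fin 5 → Fin 5 → ℂ) →ₗ[ℂ] ((Fin 5 → ℂ) × ({p : Fin 5 × Fin 5 // p.1 < p.2} → ℂ)) :=
    { toFun := fun s => (fun a => s a a, fun p => s p.1.1 p.1.2)
      map_add' := fun s t => rfl
      map_smul' := fun r s => rfl }
  have hinj : ∀ s ∈ K, ρ s = 0 → s = 0 := by
    intro s hs h0
    have hd : ∀ a, s a a = 0 := fun a => by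
      have := congr_arg (fun q => q.1 a) h0
      simpa [ρ] using this
    have hu : ∀ a b : Fin 5, a < b → s a b = 0 := fun a b hab => by
      have := congr_arg (fun q => q.2 ⟨(a, b), hab⟩) h0
      simpa [ρ] using this
    funext a b
    rcases lt_trichotomy a b with h | rfl | h
    · exact hu a b h
    · exact hd a
    · have h1 := hK s hs a b (ne_of_gt h)
      rw [hu b a h, add_zero] at h1
      exact h1
  have hinjK : Function.Injective (ρ.domRestrict K) := by
    intro x y hxy
    apply Subtype.ext
    have h : ρ (x.1 - y.1) = 0 := by
      rw [map_sub, sub_eq_zero]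
      exact hxy
    have := hinj _ (K.sub_mem x.2 y.2) h
    exact sub_eq_zero.mp this
  have hle := LinearMap.finrank_le_finrank_of_injective hinjK
  have hcard : Fintype.card {p : Fin 5 × Fin 5 // p.1 < p.2} = 10 := by decide
  have htarget : finrank ℂ ((Fin 5 → ℂ) × ({p : Fin 5 × Fin 5 // p.1 < p.2} → ℂ)) = 15 := by
    rw [Module.finrank_prod]
    simp [hcard]
  omega

/-- **Corollary (rank ≥ 10).**  If every row relation of `N` has antisymmetric off-diagonal part (✓ `offDiag_entries_independent`),
the columns of `N` do not lie in the span of fewer than `10` matrices. [folklore] -/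
theorem ten_le_of_offDiag_relations {κ : Type*} {n : ℕ} (N : Fin 5 → Fin 5 → κ → ℂ) (v : Fin n → (Fin 5 → Fin 5 → ℂ))
    (hcol : ∀ k : κ, (fun a b => N a b k) ∈ Submodule.span ℂ (Set.range v))
    (hrel : ∀ s : Fin 5 → Fin 5 → ℂ, (∀ k : κ, ∑ a : Fin 5, ∑ b : Fin 5, s a b * N a b k = 0) →
      ∀ a b : Fin 5, a ≠ b → s a b + s b a = 0) :
    10 ≤ n := by
  classical
  -- `K` = the submodule of matrices with antisymmetric off-diagonal part
  let K : Submodule ℂ (Fin 5 → Fin 5 → ℂ) :=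
    { carrier := {s | ∀ a b : Fin 5, a ≠ b → s a b + s b a = 0}
      add_mem' := fun {s t} hs ht a b hab => by
        simp only [Set.mem_setOf_eq, Pi.add_apply] at *
        linear_combination hs a b hab + ht a b hab
      zero_mem' := fun a b _ => by simp
      smul_mem' := fun r s hs a b hab => by
        simp only [Set.mem_setOf_eq, Pi.smul_apply, smul_eq_mul] at *
        rw [← mul_add, hs a b hab, mul_zero] }
  have h25 := rank_obstruction N v hcol K (fun s hs => hrel s hs)
  have h15 := finrank_offDiag_antisym_le K (fun s hs => hs)
  omega

/-- One extra relation direction: if every `s ∈ K` satisfies `(s_{ab} + s_{ba})·w_{a₀b₀} = (s_{a₀b₀} + s_{b₀a₀})·w_{ab}` for a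
fixed weight `w` with `w_{a₀b₀} ≠ 0` (✓ `offDiag_relations_of_support_three`), then `finrank K ≤ 16`. [folklore] -/
theorem finrank_offDiag_oneRel_le (K : Submodule ℂ (Fin 5 → Fin 5 → ℂ)) (w : Fin 5 → Fin 5 → ℂ) (a₀ b₀ : Fin 5)
    (hw : w a₀ b₀ ≠ 0)
    (hK : ∀ s ∈ K, ∀ a b : Fin 5, a ≠ b → (s a b + s b a) * w a₀ b₀ = (s a₀ b₀ + s b₀ a₀) * w a b) :
    finrank ℂ K ≤ 16 := by
  classical
  let ρ : (Fin 5 → Fin 5 → ℂ) →ₗ[ℂ] (((Fin 5 → ℂ) × ({p : Fin 5 × Fin 5 // p.1 < p.2} → ℂ)) × ℂ) :=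
    { toFun := fun s => ((fun a => s a a, fun p => s p.1.1 p.1.2), s a₀ b₀ + s b₀ a₀)
      map_add' := fun s t => Prod.ext rfl (by
        show (s + t) a₀ b₀ + (s + t) b₀ a₀ = (s a₀ b₀ + s b₀ a₀) + (t a₀ b₀ + t b₀ a₀)
        simp only [Pi.add_apply]
        ring)
      map_smul' := fun r s => Prod.ext rfl (by
        show (r • s) a₀ b₀ + (r • s) b₀ a₀ = r • (s a₀ b₀ + s b₀ a₀)
        simp only [Pi.smul_apply, smul_eq_mul]
        ring) }
  have hinj : ∀ s ∈ K, ρ s = 0 → s = 0 := by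
    intro s hs h0
    have hd : ∀ a, s a a = 0 := fun a => by
      have := congr_arg (fun q => q.1.1 a) h0
      simpa [ρ] using this
    have hu : ∀ a b : Fin 5, a < b → s a b = 0 := fun a b hab => by
      have := congr_arg (fun q => q.1.2 ⟨(a, b), hab⟩) h0
      simpa [ρ] using this
    have hg : s a₀ b₀ + s b₀ a₀ = 0 := by
      have := congr_arg (fun q => q.2) h0
      simpa [ρ] using this
    have hsum : ∀ a b : Fin 5, a ≠ b → s a b + s b a = 0 := fun a b hab => by
      have h1 := hK s hs a b hab
      rw [hg, zero_mul] at h1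
      exact (mul_eq_zero.mp h1).resolve_right hw
    funext a b
    rcases lt_trichotomy a b with h | rfl | h
    · exact hu a b h
    · exact hd a
    · have h1 := hsum a b (ne_of_gt h)
      rw [hu b a h, add_zero] at h1
      exact h1
  have hinjK : Function.Injective (ρ.domRestrict K) := by
    intro x y hxy
    apply Subtype.ext
    have h : ρ (x.1 - y.1) = 0 := by
      rw [map_sub, sub_eq_zero]
      exact hxy
    exact sub_eq_zero.mp (hinj _ (K.sub_mem x.2 y.2) h)
  have hle := LinearMap.finrank_le_finrank_of_injective hinjK
  have hcard : Fintype.card {p : Fin 5 × Fin 5 // p.1 < p.2} = 10 := by decide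
  have htarget : finrank ℂ (((Fin 5 → ℂ) × ({p : Fin 5 × Fin 5 // p.1 < p.2} → ℂ)) × ℂ) = 16 := by
    rw [Module.finrank_prod, Module.finrank_prod]
    simp [hcard]
  omega

/-- **Corollary (rank ≥ 9).**  If every row relation `s` of `N` satisfies `(s_{ab}+s_{ba}) w_{a₀b₀} = (s_{a₀b₀}+s_{b₀a₀}) w_{ab}`
(`w_{a₀b₀} ≠ 0`), the columns of `N` do not lie in the span of fewer than `9` matrices. [folklore] -/
theorem nine_le_of_offDiag_oneRel {κ : Type*} {n : ℕ} (N : Fin 5 → Fin 5 → κ → ℂ) (v : Fin n → (Fin 5 → Fin 5 → ℂ))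
    (hcol : ∀ k : κ, (fun a b => N a b k) ∈ Submodule.span ℂ (Set.range v))
    (w : Fin 5 → Fin 5 → ℂ) (a₀ b₀ : Fin 5) (hw : w a₀ b₀ ≠ 0)
    (hrel : ∀ s : Fin 5 → Fin 5 → ℂ, (∀ k : κ, ∑ a : Fin 5, ∑ b : Fin 5, s a b * N a b k = 0) →
      ∀ a b : Fin 5, a ≠ b → (s a b + s b a) * w a₀ b₀ = (s a₀ b₀ + s b₀ a₀) * w a b) :
    9 ≤ n := by
  classical
  let K : Submodule ℂ (Fin 5 → Fin 5 → ℂ) :=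
    { carrier := {s | ∀ a b : Fin 5, a ≠ b → (s a b + s b a) * w a₀ b₀ = (s a₀ b₀ + s b₀ a₀) * w a b}
      add_mem' := fun {s t} hs ht a b hab => by
        simp only [Set.mem_setOf_eq, Pi.add_apply] at *
        linear_combination hs a b hab + ht a b hab
      zero_mem' := fun a b _ => by simp
      smul_mem' := fun r s hs a b hab => by
        simp only [Set.mem_setOf_eq, Pi.smul_apply, smul_eq_mul] at *
        linear_combination r * hs a b hab }
  have h25 := rank_obstruction N v hcol K (fun s hs => hrel s hs)
  have h16 := finrank_offDiag_oneRel_le K w a₀ b₀ hw (fun s hs => hs)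
  omega

end LaplaceFiveStar

end Summit.ValiantsHypothesis.ValiantsHypothesis.Theorems.RigidityForcesSymmetryRankRigidMinimalRepr
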